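import Summits.Ventures.HodgeRepro2.T7SupportBergmanOneVectorFourier
import Summits.Ventures.HodgeRepro2.T5BergmanSchurGeneral
import Summits.Ventures.HodgeRepro2.T5BergmanCoeffL2

/-!
# The one-vector coefficients of two different weights are orthogonal in `L²(SU(1,1))` (support, seat p1)

L3-ARGUMENT §2g (2): «`R(f_v)` … kills every `σ ≇ π⁰_v`». For the line's one-vector test function of the weight-`k`
series, `f_k(g) = ⟨π_k(g) 1, 1⟩_k = a(g)^{−k} ⟨1,1⟩_k`, and the same coefficient of the weight-`k'` series, `k ≠ k'`,
the Schur orthogonality of INEQUIVALENT discrete series is, for these two vectors, the one-line `K`-averaging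
(`T5BergmanCoeffL2.integral_integral_mul_rot`, Rühl's Haar measure `μ_R`): `f_k(g · rot u) = u^{−k} f_k(g)`, so

  `∫_{SU(1,1)} conj(f_k) · f_{k'} dμ_R = ∫_G (∫_K u^{k − k'} du) conj(f_k) f_{k'} dμ_R = 0`   (`integral_conj_mul_eq_zero`)

— the `(1,1)`-matrix entry of «`R(f_k)` kills `π_{k'}`» in the model (the integrability of the product from the Schur
relations `integrable_norm_matrixCoeff_sq` for each weight and `|conj(A) B| ≤ (|A|² + |B|²)/2`). The full statement for all
`σ ≇ π⁰_v` (every unitary representation, not only the holomorphic discrete series of other weights) is INPUT G (printed).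

Explicit model only; nothing about the adelic group or any period.
Blind lane: Mathlib + the HodgeRepro2 prefix only; no sorry; axioms ⊆ {propext, Classical.choice, Quot.sound}.
-/

namespace Summit.Ventures.HodgeRepro2.T7SupportBergmanWeightOrthogonal

open MeasureTheory Metric
open T5SU11Unimodular T5SU11Fibration T5SU11CoefficientL2 T5BergmanCoefficient T5BergmanMatrixCoeff T5HaarCircle
  T5BergmanActStable T5BergmanFourier T5BergmanSchurGeneral T5BergmanCoeffL2 T7SupportCartanShift
  T7SupportBergmanOneVectorDecay T7SupportBergmanOneVectorFourier

/-- `a(g · rot u) = a(g) u` -/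
theorem mat_mul_rot_zero_zero (g : SU11) (u : Circle) : mat (g * rot u) 0 0 = mat g 0 0 * (u : ℂ) := by
  rw [mat_mul_zero_zero, mat_rot]
  simp [T5PoincareDensity.su11]

/-- the right `K`-type of the one-vector coefficient: `⟨π_k(g · rot u) 1, 1⟩_k = u^{−k} ⟨π_k(g) 1, 1⟩_k` -/
theorem matrixCoeff_lowest_mul_rot (k : ℕ) (g : SU11) (u : Circle) :
    matrixCoeff k lowest lowest (g * rot u) = ((u : ℂ)⁻¹) ^ k * matrixCoeff k lowest lowest g := by
  rw [matrixCoeff_lowest_lowest, matrixCoeff_lowest_lowest, mat_mul_rot_zero_zero, mul_inv, mul_pow]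
  ring

/-- the one-vector coefficient is continuous in `g` -/
theorem continuous_matrixCoeff_lowest (k : ℕ) (hk : 2 ≤ k) : Continuous (matrixCoeff k lowest lowest) :=
  continuous_matrixCoeff_of_differentiableOn k hk lowest (differentiableOn_const 1) (integrableOn_lowest k) lowest
    (differentiableOn_const 1) (integrableOn_lowest k)

variable [MeasurableSpace Circle] [BorelSpace Circle]

/-- the one-vector coefficient is square-integrable for Rühl's Haar measure -/
theorem integrable_norm_sq_lowest (k : ℕ) (hk : 2 ≤ k) :
    Integrable (fun g => ‖matrixCoeff k lowest lowest g‖ ^ 2) ruhl :=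
  integrable_norm_matrixCoeff_sq k hk lowest lowest (differentiableOn_const 1) (integrableOn_lowest k)
    (differentiableOn_const 1) (integrableOn_lowest k)

/-- the product of two one-vector coefficients is integrable -/
theorem integrable_conj_mul (k k' : ℕ) (hk : 2 ≤ k) (hk' : 2 ≤ k') :
    Integrable (fun g => (starRingEnd ℂ) (matrixCoeff k lowest lowest g) * matrixCoeff k' lowest lowest g) ruhl := by
  have hcont : Continuous fun g => (starRingEnd ℂ) (matrixCoeff k lowest lowest g) * matrixCoeff k' lowest lowest g :=
    (Complex.continuous_conj.comp (continuous_matrixCoeff_lowest k hk)).mul (continuous_matrixCoeff_lowest k' hk')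
  refine Integrable.mono' (((integrable_norm_sq_lowest k hk).add (integrable_norm_sq_lowest k' hk')).div_const 2)
    hcont.aestronglyMeasurable (Filter.Eventually.of_forall fun g => ?_)
  have := norm_mul_conj_le (matrixCoeff k' lowest lowest g) (matrixCoeff k lowest lowest g)
  rw [mul_comm] at this
  simpa [add_comm] using this

/-- **the one-vector coefficients of two different weights are orthogonal**:
`∫_{SU(1,1)} conj ⟨π_k(g) 1, 1⟩_k · ⟨π_{k'}(g) 1, 1⟩_{k'} dμ_R = 0` for `k ≠ k'` -/
theorem integral_conj_mul_eq_zero (k k' : ℕ) (hk : 2 ≤ k) (hk' : 2 ≤ k') (hne : k ≠ k') :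
    ∫ g, (starRingEnd ℂ) (matrixCoeff k lowest lowest g) * matrixCoeff k' lowest lowest g ∂ruhl = 0 := by
  set F : SU11 → ℂ := fun g => (starRingEnd ℂ) (matrixCoeff k lowest lowest g) * matrixCoeff k' lowest lowest g
    with hF
  have hcont : Continuous F :=
    (Complex.continuous_conj.comp (continuous_matrixCoeff_lowest k hk)).mul (continuous_matrixCoeff_lowest k' hk')
  have hint : Integrable F ruhl := integrable_conj_mul k k' hk hk'
  rw [← integral_integral_mul_rot ruhl hcont hint]
  -- `F (g · rot u) = u^{k − k'} F g`, whose circle integral vanishes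
  have e : ∀ g : SU11, ∀ u : Circle, F (g * rot u) =
      F g * ((u : ℂ) ^ ((k : ℤ) - (k' : ℤ)) * (starRingEnd ℂ) ((u : ℂ) ^ (0 : ℤ))) := by
    intro g u
    rw [hF]
    simp only
    rw [matrixCoeff_lowest_mul_rot k g u, matrixCoeff_lowest_mul_rot k' g u, map_mul, map_pow, map_inv₀,
      ← Circle.coe_inv_eq_conj, Circle.coe_inv, inv_inv, zpow_zero, map_one, mul_one, zpow_sub₀ (Circle.coe_ne_zero u),
      zpow_natCast, zpow_natCast, inv_pow]
    field_simp
  simp_rw [e]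
  have h0 : ∀ g : SU11, ∫ u : Circle, F g * ((u : ℂ) ^ ((k : ℤ) - (k' : ℤ)) * (starRingEnd ℂ) ((u : ℂ) ^ (0 : ℤ)))
      ∂haarCircle = 0 := by
    intro g
    rw [integral_const_mul, integral_zpow_mul_conj_zpow, if_neg, mul_zero]
    intro h
    apply hne
    have : (k : ℤ) = k' := by linarith
    exact_mod_cast this
  simp_rw [h0]
  simp

end Summit.Ventures.HodgeRepro2.T7SupportBergmanWeightOrthogonal
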